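import Literature.NumberTheory.NumberFields.NarrowClassGroupCounting
import HarnessLib

/-!
# Narrow Fukuda, brick (D⁺): the narrow elementary `p`-class field of a subfield `M ⊆ F` sits inside the big Hilbert class field `K¹(F)` —
# `[Cl⁺_M : (Cl⁺_M)^p] ∣ [Gal(K¹(F)/M) : Gal(K¹(F)/M)'·⟨inertia⟩·Gal(K¹(F)/M)^p]`

Topic `NumberTheory/IwasawaTheory` (namespace `Literature.NumberTheory.NumberFields`, next to its wide sibling). THEOREM-ONLY file (no definition,
no named fact, no `sorry`), written by the prover seat `cruxlead-stmt-BirchSwinnertonDyer-19573-w2` GEN 9 (cell `bsd-2adic`; `--supports`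
stmt-BirchSwinnertonDyer-19573; closes nothing).  Second brick of «NARROW FUKUDA» (Fukuda 1994 Thm. 1 (2) for narrow class groups): the NARROW twin
of `FukudaPElementaryInclusion.index_range_pow_dvd_index_commutator_sup_inertia_sup_pow` (seat `bsd-potss-k8t-c4` g20, followed line by line).
The wide brick works inside the `p`-Hilbert class field `H_p ⊆ H_F`; the narrow rank statement needs no `p`-parts, so here the ambient field is
the whole big Hilbert class field `K¹(F) = narrowRayClassField F ⊤` (Neukirch VI (6.8): maximal abelian extension of `F` unramified at all FINITE
primes; degree `h⁺(F)`), and every condition at the infinite places disappears.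

STATEMENT (`index_range_pow_narrowClassGroup_dvd_index_commutator_sup_inertia_sup_pow`): `F/M` finite Galois, `K¹ = K¹(F)` Galois over `M`,
`G = Gal(K¹/M)`, `N = G' ⊔ ⨆_𝔔 I(𝔔)` (`𝔔` the maximal ideals of `𝓞 K¹`), `G^p = ⟨σ^p⟩`; then `[Cl⁺_M : (Cl⁺_M)^p] ∣ [G : N ⊔ G^p]`.
PROOF: brick 1 (`NarrowClassGroupCounting.exists_intermediateField_pElementaryNarrow`) puts a copy `P ⊆ F̄` of the narrow elementary `p`-class
field of `M` (abelian, unramified at the finite primes, exponent `p`, degree `[Cl⁺_M : (Cl⁺_M)^p]`); the compositum `L = P·F ⊆ F̄` is abelian over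
`F` and unramified over `F` at every finite prime (base change, `UnramifiedAbelianBaseChange`), so `L ⊆ K¹(F)` (maximality,
`le_narrowRayClassField_top_of_forall_isUnramifiedIn`); thus `P` is a subextension `Pq` of `K¹/M`, abelian of exponent `p` and unramified at the
finite primes, and `N ⊔ G^p ≤ Gal(K¹/Pq)`, whose index is `[Pq : M] = [Cl⁺_M : (Cl⁺_M)^p]`.

References: [Fukuda1994] Thm. 1 (2), p. 264; [Washington1997] §13.3 Lemma 13.15, Prop. 13.23; [NeukirchANT1999] Ch. VI §6 Prop. (6.8);
[Lang1990] Ch. 3 §4 (Lemma to Thm. 4.3), Ch. 13 §2; [GreenbergLNM1716] p. 122.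
-/

noncomputable section

open scoped NumberField
open NumberField IsDedekindDomain Field IntermediateField

namespace Literature.NumberTheory.NumberFields

open scoped Pointwise
open Literature.NumberTheory.GaloisRepresentations

set_option maxHeartbeats 1600000 in
set_option synthInstance.maxHeartbeats 200000 in
/-- **The narrow elementary `p`-class field of `M` inside the big Hilbert class field of `F ⊇ M`:
`[Cl⁺_M : (Cl⁺_M)^p] ∣ [G : G'·⟨inertia⟩·G^p]`.**  Let `F/M` be a finite Galois extension of number fields and `K¹ = K¹(F)` the big Hilbert class
field of `F` (an intermediate field of `F̄/F`), Galois over `M`.  For `G = Gal(K¹/M)`, `N = G' ⊔ ⨆_𝔔 I(𝔔)` (commutators and the inertia groups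
of all maximal ideals of `𝓞 K¹`) and `G^p` the subgroup generated by the `p`-th powers, `[Cl⁺_M : (Cl⁺_M)^p] ∣ [G : N ⊔ G^p]`.
[cite: Fukuda1994, Thm. 1 (2), p. 264 (proof)] [cite: Washington1997, §13.3 Lemma 13.15 and Prop. 13.23 (proof)]
[cite: NeukirchANT1999, Ch. VI §6 Prop. (6.8)] [cite: Lang1990, Ch. 3 §4, Lemma to Thm. 4.3, and Ch. 13 §2] -/
theorem index_range_pow_narrowClassGroup_dvd_index_commutator_sup_inertia_sup_pow
    (M F : Type) [Field M] [NumberField M] [Field F] [NumberField F] [Algebra M F] [IsGalois M F] (p : ℕ)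
    [IsGalois M (narrowRayClassField F (top_ne_bot : (⊤ : Ideal (𝓞 F)) ≠ ⊥))] :
    (powMonoidHom (α := NarrowClassGroup M) p).range.index ∣
      ((⁅(⊤ : Subgroup ((narrowRayClassField F (top_ne_bot : (⊤ : Ideal (𝓞 F)) ≠ ⊥)) ≃ₐ[M]
          (narrowRayClassField F (top_ne_bot : (⊤ : Ideal (𝓞 F)) ≠ ⊥)))), ⊤⁆ ⊔
        ⨆ (Q : MaximalSpectrum (𝓞 (narrowRayClassField F (top_ne_bot : (⊤ : Ideal (𝓞 F)) ≠ ⊥)))),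
          Q.asIdeal.inertia ((narrowRayClassField F (top_ne_bot : (⊤ : Ideal (𝓞 F)) ≠ ⊥)) ≃ₐ[M]
            (narrowRayClassField F (top_ne_bot : (⊤ : Ideal (𝓞 F)) ≠ ⊥)))) ⊔
        Subgroup.closure (Set.range fun σ : (narrowRayClassField F (top_ne_bot : (⊤ : Ideal (𝓞 F)) ≠ ⊥)) ≃ₐ[M]
          (narrowRayClassField F (top_ne_bot : (⊤ : Ideal (𝓞 F)) ≠ ⊥)) => σ ^ p)).index := by
  classical
  let Ω := AlgebraicClosure F
  haveI : FiniteDimensional M F := inferInstance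
  haveI : Algebra.IsAlgebraic M Ω := Algebra.IsAlgebraic.trans M F Ω
  haveI : FiniteDimensional M (narrowRayClassField F (top_ne_bot : (⊤ : Ideal (𝓞 F)) ≠ ⊥)) :=
    Module.Finite.trans F (narrowRayClassField F (top_ne_bot : (⊤ : Ideal (𝓞 F)) ≠ ⊥))
  -- the class field of `(Cl⁺_M)^p`, realised in `Ω = \bar F`
  obtain ⟨P, hPfd, hPab, hPunr, hPexp, hPdeg⟩ := exists_intermediateField_pElementaryNarrow M p Ω
  haveI := hPfd
  haveI := hPab
  haveI : NumberField P := NumberField.of_module_finite M P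
  -- the copy `F₀` of `F` in `Ω` over `M`, and the compositum `L₀ = P F₀`
  set F₀ : IntermediateField M Ω := (IsScalarTower.toAlgHom M F Ω).fieldRange with hF₀
  let eF : F ≃ₐ[M] F₀ := AlgEquiv.ofInjectiveField (IsScalarTower.toAlgHom M F Ω)
  haveI : FiniteDimensional M F₀ := LinearEquiv.finiteDimensional eF.toLinearEquiv
  haveI : IsGalois M F₀ := IsGalois.of_algEquiv eF
  set L₀ : IntermediateField M Ω := P ⊔ F₀ with hL₀
  haveI : FiniteDimensional M L₀ := IntermediateField.finiteDimensional_sup P F₀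
  -- `L₀` as an intermediate field OVER `F`
  have hFmem : ∀ x : F, algebraMap F Ω x ∈ L₀ := fun x =>
    (le_sup_right : F₀ ≤ L₀) ⟨x, rfl⟩
  let L : IntermediateField F Ω := L₀.toSubfield.toIntermediateField hFmem
  have hLres : L.restrictScalars M = L₀ := by ext x; exact Iff.rfl
  haveI : FiniteDimensional M L := by
    have : FiniteDimensional M (L.restrictScalars M) := by rw [hLres]; infer_instance
    exact this
  haveI : FiniteDimensional F L := Module.Finite.of_restrictScalars_finite M F L
  haveI : NumberField L := NumberField.of_module_finite F L
  -- base change inside `T = L`: `K₁ = P`, `L₁ = F`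
  let val : L →ₐ[M] Ω := (L.val).restrictScalars M
  have hval : ∀ x : L, val x = (x : Ω) := fun _ => rfl
  have hrange : val.fieldRange = L₀ := by
    ext x
    constructor
    · rintro ⟨y, rfl⟩; exact y.2
    · intro hx; exact ⟨⟨x, hx⟩, rfl⟩
  let K₁ : IntermediateField M L := P.comap val
  let L₁ : IntermediateField M L := (⊥ : IntermediateField F L).restrictScalars M
  have hK₁map : K₁.map val = P := IntermediateField.map_comap_eq_self (by rw [hrange]; exact le_sup_left)
  have hL₁map : L₁.map val = F₀ := by
    ext x
    constructor
    · rintro ⟨y, hy, rfl⟩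
      obtain ⟨z, hz⟩ := (IntermediateField.mem_bot.mp hy)
      refine ⟨z, ?_⟩
      change algebraMap F Ω z = ((y : L) : Ω)
      rw [← hz]; rfl
    · rintro ⟨z, rfl⟩
      refine ⟨⟨algebraMap F Ω z, hFmem z⟩, ?_, rfl⟩
      change (⟨algebraMap F Ω z, hFmem z⟩ : L) ∈ (⊥ : IntermediateField F L)
      exact IntermediateField.mem_bot.mpr ⟨z, rfl⟩
  have hsup : K₁ ⊔ L₁ = ⊤ := by
    apply IntermediateField.map_injective val
    rw [IntermediateField.map_sup, hK₁map, hL₁map, ← hL₀, ← hrange]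
    ext x
    constructor
    · rintro ⟨y, rfl⟩; exact ⟨y, trivial, rfl⟩
    · rintro ⟨y, -, rfl⟩; exact ⟨y, rfl⟩
  -- `K₁ ≅ P` over `M`
  let fK : K₁ →ₐ[M] P := (val.comp K₁.val).codRestrict P.toSubalgebra (fun y => y.2)
  haveI : FiniteDimensional M K₁ :=
    FiniteDimensional.of_injective fK.toLinearMap (fun a b h => by
      apply Subtype.ext; apply Subtype.ext
      have := congrArg (fun z : P => (z : Ω)) h
      exact this)
  haveI : IsAbelianGalois M K₁ := IsAbelianGalois.of_algHom fK
  haveI : NumberField K₁ := NumberField.of_module_finite M K₁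
  haveI : NumberField L₁ := NumberField.of_module_finite M L₁
  have hunrK₁ : ∀ v : HeightOneSpectrum (𝓞 M), Algebra.IsUnramifiedIn (𝓞 K₁) v.asIdeal :=
    forall_isUnramifiedIn_of_algHom fK hPunr
  haveI hLab : IsAbelianGalois L₁ L := isAbelianGalois_right_of_sup_eq_top K₁ L₁ hsup
  have hLunr : ∀ w : HeightOneSpectrum (𝓞 L₁), Algebra.IsUnramifiedIn (𝓞 L) w.asIdeal :=
    isUnramifiedIn_right_of_sup_eq_top K₁ L₁ hunrK₁ hsup
  have hfKbij : Function.Bijective fK := by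
    refine ⟨fun a b h => ?_, fun z => ?_⟩
    · apply Subtype.ext; apply Subtype.ext
      exact congrArg (fun z : P => (z : Ω)) h
    · have hzL : (z : Ω) ∈ L₀ := (le_sup_left : P ≤ L₀) z.2
      refine ⟨⟨⟨z, hzL⟩, ?_⟩, Subtype.ext rfl⟩
      change val ⟨z, hzL⟩ ∈ P
      exact z.2
  -- from `L₁ = F` (inside `L`) to `F`
  have hbot : ∀ y : L₁, ∃ z : F, algebraMap F L z = (y : L) := fun y => IntermediateField.mem_bot.mp y.2
  -- every `F`-automorphism of `L` is an `L₁`-automorphism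
  have lift : ∀ σ : L ≃ₐ[F] L, ∃ σ' : L ≃ₐ[L₁] L, ∀ x, σ' x = σ x := by
    intro σ
    refine ⟨{ σ with commutes' := ?_ }, fun _ => rfl⟩
    intro y
    obtain ⟨z, hz⟩ := hbot y
    change σ (y : L) = (y : L)
    rw [← hz, AlgEquiv.commutes]
  -- `L/F` is abelian
  haveI : Normal M L := by
    have : Normal M (L.restrictScalars M) := by rw [hLres]; infer_instance
    exact this
  haveI : IsGalois M L := IsGalois.mk
  haveI : IsGalois F L := IsGalois.tower_top_of_isGalois M F L
  haveI : IsAbelianGalois F L := by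
    refine { is_comm := ⟨fun σ τ => ?_⟩ }
    obtain ⟨σ', hσ'⟩ := lift σ
    obtain ⟨τ', hτ'⟩ := lift τ
    have hc := hLab.is_comm.comm σ' τ'
    ext x
    have := congrArg (fun f : L ≃ₐ[L₁] L => f x) hc
    simp only [AlgEquiv.mul_apply] at this ⊢
    rw [← hσ', ← hτ', this, hτ', hσ']
  -- `L/F` is unramified at every finite prime: its inertia groups over `F` are inertia groups over `L₁`, which are trivial
  have hunrL : ∀ v : HeightOneSpectrum (𝓞 F), Algebra.IsUnramifiedIn (𝓞 L) v.asIdeal := by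
    intro v Q hQ hQv
    haveI := hQ
    have hQ0 : Q ≠ ⊥ := by
      intro h0
      apply v.ne_bot
      rw [hQv.over, h0, Ideal.under_def, Ideal.comap_bot_of_injective _
        (FaithfulSMul.algebraMap_injective (𝓞 F) (𝓞 L))]
    haveI : Q.IsMaximal := hQ.isMaximal hQ0
    -- the inertia group over `L₁` is trivial
    have hw0 : Q.under (𝓞 L₁) ≠ ⊥ := mt Ideal.eq_bot_of_comap_eq_bot hQ0
    haveI : (Q.under (𝓞 L₁)).IsMaximal := Ideal.IsMaximal.under (𝓞 L₁) Q
    let w : HeightOneSpectrum (𝓞 L₁) := ⟨Q.under (𝓞 L₁), inferInstance, hw0⟩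
    haveI : Algebra.IsUnramifiedAt (𝓞 L₁) Q := hLunr w Q hQ ⟨rfl⟩
    have hI₁ : Q.inertia (L ≃ₐ[L₁] L) = ⊥ := by
      apply Subgroup.eq_bot_of_card_eq
      rw [card_inertia_eq_ramificationIdx L (L ≃ₐ[L₁] L) L₁ Q]
      exact Ideal.ramificationIdx_eq_one _ _
    -- hence so is the one over `F`
    have hI : Q.inertia (L ≃ₐ[F] L) = ⊥ := by
      rw [eq_bot_iff]
      intro σ hσ
      obtain ⟨σ', hσ'⟩ := lift σ
      have hσ'I : σ' ∈ Q.inertia (L ≃ₐ[L₁] L) := fun y => by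
        have h1 := hσ y
        change σ' • y - y ∈ Q
        have h2 : σ' • y = σ • y := by
          apply Subtype.ext
          change σ' (y : L) = σ (y : L)
          exact hσ' y
        rw [h2]; exact h1
      rw [hI₁, Subgroup.mem_bot] at hσ'I
      rw [Subgroup.mem_bot]
      ext x
      rw [← hσ' x, hσ'I, AlgEquiv.one_apply, AlgEquiv.one_apply]
    have he : Q.ramificationIdx (𝓞 F) = 1 := by
      rw [← card_inertia_eq_ramificationIdx L (L ≃ₐ[F] L) F Q, hI, Subgroup.card_bot]
    exact (Ideal.ramificationIdx_eq_one_iff).mp he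
  -- maximality of the big Hilbert class field: `L ≤ K¹(F)`
  have hLH : L ≤ narrowRayClassField F (top_ne_bot : (⊤ : Ideal (𝓞 F)) ≠ ⊥) :=
    le_narrowRayClassField_top_of_forall_isUnramifiedIn L hunrL
  -- `P` as an intermediate field `Pq` of `K¹/M`
  let valq : (narrowRayClassField F (top_ne_bot : (⊤ : Ideal (𝓞 F)) ≠ ⊥)) →ₐ[M] Ω :=
    ((narrowRayClassField F (top_ne_bot : (⊤ : Ideal (𝓞 F)) ≠ ⊥)).val).restrictScalars M
  have hvalq : ∀ x : (narrowRayClassField F (top_ne_bot : (⊤ : Ideal (𝓞 F)) ≠ ⊥)), valq x = (x : Ω) := fun _ => rfl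
  let Pq : IntermediateField M (narrowRayClassField F (top_ne_bot : (⊤ : Ideal (𝓞 F)) ≠ ⊥)) := P.comap valq
  let fq : Pq →ₐ[M] P := (valq.comp Pq.val).codRestrict P.toSubalgebra (fun y => y.2)
  have hfqbij : Function.Bijective fq := by
    refine ⟨fun a b h => ?_, fun z => ?_⟩
    · apply Subtype.ext; apply Subtype.ext
      exact congrArg (fun z : P => (z : Ω)) h
    · have hzL : (z : Ω) ∈ L := (le_sup_left : P ≤ L₀) z.2
      refine ⟨⟨⟨z, hLH hzL⟩, ?_⟩, Subtype.ext rfl⟩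
      change valq ⟨z, hLH hzL⟩ ∈ P
      exact z.2
  haveI : FiniteDimensional M Pq := FiniteDimensional.of_injective fq.toLinearMap hfqbij.1
  have hPqdeg : Module.finrank M Pq = (powMonoidHom (α := NarrowClassGroup M) p).range.index := by
    rw [← hPdeg]; exact (LinearEquiv.ofBijective fq.toLinearMap hfqbij).finrank_eq
  haveI : IsAbelianGalois M Pq := IsAbelianGalois.of_algHom fq
  haveI : NumberField Pq := NumberField.of_module_finite M Pq
  have hunrPq : ∀ v : HeightOneSpectrum (𝓞 M), Algebra.IsUnramifiedIn (𝓞 Pq) v.asIdeal :=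
    forall_isUnramifiedIn_of_algHom fq hPunr
  have hPqexp : ∀ τ : Pq ≃ₐ[M] Pq, τ ^ p = 1 := by
    intro τ
    obtain ⟨σ, rfl⟩ := (AlgEquiv.autCongr (AlgEquiv.ofBijective fq hfqbij).symm).surjective τ
    rw [← map_pow, hPexp, map_one]
  haveI : NumberField (narrowRayClassField F (top_ne_bot : (⊤ : Ideal (𝓞 F)) ≠ ⊥)) := inferInstance
  -- the subgroup `S = Gal(K¹/Pq)` contains `N ⊔ G^p`
  set S : Subgroup ((narrowRayClassField F (top_ne_bot : (⊤ : Ideal (𝓞 F)) ≠ ⊥)) ≃ₐ[M]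
      (narrowRayClassField F (top_ne_bot : (⊤ : Ideal (𝓞 F)) ≠ ⊥))) := Pq.fixingSubgroup with hS
  have hcommS : ⁅(⊤ : Subgroup ((narrowRayClassField F (top_ne_bot : (⊤ : Ideal (𝓞 F)) ≠ ⊥)) ≃ₐ[M]
      (narrowRayClassField F (top_ne_bot : (⊤ : Ideal (𝓞 F)) ≠ ⊥)))), ⊤⁆ ≤ S := by
    rw [hS, ← IntermediateField.restrictNormalHom_ker Pq, ← commutator_def]
    letI : CommGroup (Pq ≃ₐ[M] Pq) :=
      { (inferInstance : Group (Pq ≃ₐ[M] Pq)) with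
        mul_comm := fun a b => (IsMulCommutative.is_comm (M := Pq ≃ₐ[M] Pq)).comm a b }
    exact Abelianization.commutator_subset_ker _
  have hIS : ∀ Q : MaximalSpectrum (𝓞 (narrowRayClassField F (top_ne_bot : (⊤ : Ideal (𝓞 F)) ≠ ⊥))),
      Q.asIdeal.inertia ((narrowRayClassField F (top_ne_bot : (⊤ : Ideal (𝓞 F)) ≠ ⊥)) ≃ₐ[M]
        (narrowRayClassField F (top_ne_bot : (⊤ : Ideal (𝓞 F)) ≠ ⊥))) ≤ S := by
    intro Q
    haveI := Q.isMaximal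
    have hQ0 : Q.asIdeal ≠ ⊥ := Ring.ne_bot_of_isMaximal_of_not_isField Q.isMaximal (RingOfIntegers.not_isField _)
    haveI : (Q.asIdeal.under (𝓞 Pq)).IsMaximal := Ideal.IsMaximal.under (𝓞 Pq) Q.asIdeal
    haveI : (Q.asIdeal.under (𝓞 M)).IsMaximal := Ideal.IsMaximal.under (𝓞 M) Q.asIdeal
    have hv0 : Q.asIdeal.under (𝓞 M) ≠ ⊥ := mt Ideal.eq_bot_of_comap_eq_bot hQ0
    let v : HeightOneSpectrum (𝓞 M) := ⟨Q.asIdeal.under (𝓞 M), inferInstance, hv0⟩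
    haveI : Algebra.IsUnramifiedAt (𝓞 M) (Q.asIdeal.under (𝓞 Pq)) :=
      hunrPq v (Q.asIdeal.under (𝓞 Pq)) inferInstance ⟨(Ideal.under_under (B := 𝓞 Pq) Q.asIdeal).symm⟩
    rw [hS, ← isUnramifiedAt_under_iff_inertia_le' Pq Q.asIdeal]
    infer_instance
  have hpowS : Subgroup.closure (Set.range fun σ : (narrowRayClassField F (top_ne_bot : (⊤ : Ideal (𝓞 F)) ≠ ⊥)) ≃ₐ[M]
      (narrowRayClassField F (top_ne_bot : (⊤ : Ideal (𝓞 F)) ≠ ⊥)) => σ ^ p) ≤ S := by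
    rw [Subgroup.closure_le]
    rintro _ ⟨σ, rfl⟩
    rw [SetLike.mem_coe, hS, ← IntermediateField.restrictNormalHom_ker Pq, MonoidHom.mem_ker, map_pow]
    exact hPqexp _
  have hNS : (⁅(⊤ : Subgroup ((narrowRayClassField F (top_ne_bot : (⊤ : Ideal (𝓞 F)) ≠ ⊥)) ≃ₐ[M]
        (narrowRayClassField F (top_ne_bot : (⊤ : Ideal (𝓞 F)) ≠ ⊥)))), ⊤⁆ ⊔
        ⨆ (Q : MaximalSpectrum (𝓞 (narrowRayClassField F (top_ne_bot : (⊤ : Ideal (𝓞 F)) ≠ ⊥)))),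
          Q.asIdeal.inertia ((narrowRayClassField F (top_ne_bot : (⊤ : Ideal (𝓞 F)) ≠ ⊥)) ≃ₐ[M]
            (narrowRayClassField F (top_ne_bot : (⊤ : Ideal (𝓞 F)) ≠ ⊥)))) ⊔
      Subgroup.closure (Set.range fun σ : (narrowRayClassField F (top_ne_bot : (⊤ : Ideal (𝓞 F)) ≠ ⊥)) ≃ₐ[M]
        (narrowRayClassField F (top_ne_bot : (⊤ : Ideal (𝓞 F)) ≠ ⊥)) => σ ^ p) ≤ S :=
    sup_le (sup_le hcommS (iSup_le hIS)) hpowS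
  -- `[G : S] = [Pq : M] = [Cl⁺_M : (Cl⁺_M)^p]`
  have hSindex : S.index = (powMonoidHom (α := NarrowClassGroup M) p).range.index := by
    rw [← hPqdeg]
    have h1 : S.index * Nat.card S = Nat.card ((narrowRayClassField F (top_ne_bot : (⊤ : Ideal (𝓞 F)) ≠ ⊥)) ≃ₐ[M]
        (narrowRayClassField F (top_ne_bot : (⊤ : Ideal (𝓞 F)) ≠ ⊥))) := S.index_mul_card
    rw [hS, IsGalois.card_fixingSubgroup_eq_finrank Pq, IsGalois.card_aut_eq_finrank,
      ← Module.finrank_mul_finrank M Pq (narrowRayClassField F (top_ne_bot : (⊤ : Ideal (𝓞 F)) ≠ ⊥))] at h1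
    exact Nat.eq_of_mul_eq_mul_right Module.finrank_pos h1
  rw [← hSindex]
  exact Subgroup.index_dvd_of_le hNS

end Literature.NumberTheory.NumberFields

end
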